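import Literature.Geometry.Kaehler.ComplexTorusThetaDivisorComponentsIrreducible
import Literature.Geometry.Kaehler.ComplexTorusProductFamilyAdditionIsomorphism
import Literature.Geometry.Kaehler.ComplexTorusPolarizedDecompositionUniqueExternal
import HarnessLib

/-!
# Clemens–Griffiths 1972, Lemma 3.20 (i)+(ii) externally: `(X, Θ) ≅ ∏_C (B_C, η|_{B_C})` with `Θ_C` the
# cylinder over the theta divisor of the factor `𝒯_C`

Layer `Literature/Geometry/Kaehler`, namespace `Literature.Geometry.Kaehler.ComplexTorus`; lane `lit-hodgefound`
(Track 2 foundations library), skeleton seat `lit-hodgefound-skel-2` (generation 35), plan row A2-129 — sequel of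
A2-126 (`ComplexTorusThetaDivisorComponentsProductFamily`: the `U_C = Λ(η − η_C)⁰` form a product family with
principally polarised factors `B_C`), A2-127 (`ComplexTorusThetaDivisorComponentsIrreducible`: `Θ_C + K_C = Θ_C`,
the factors are irreducible p.p.a.v.'s, `ι_{B_C}⁻¹(Θ_C)` is irreducible and is the divisor of the restricted
theta function) and A2-128 (`ComplexTorusProductFamilyAdditionIsomorphism`: the addition map of a product family
is an isomorphism of polarised tori `(∏_k Y_{V_k}, ⊞ η|) ⥲ (X, η)`; cylinders). THEOREMS ONLY (no definition,
no named fact, net debt `0`).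

## Source, VERBATIM

C. H. Clemens, P. A. Griffiths, *The intermediate Jacobian of the cubic threefold*, Ann. of Math. **95**
(1972), §3 p. 296–297 (held `paper:doi-10-2307-1970801`, p0017 L45 – p0018 L20): "**LEMMA 3.20.** Let
`𝒯 = (W, U, ℋ)` be a principally polarized abelian variety […] `Θ = Σ_{i=1}^n Θ_i` where the `Θ_i` are
irreducible (possibly singular) hypersurfaces […]. Then there exist principally polarized abelian varieties
`𝒯_i = (W_i, U_i, ℋ_i)` such that: (i) `𝒯 ≅ 𝒯_1 ⊕ ⋯ ⊕ 𝒯_n`, (ii) under the isomorphism (i), `Θ_i`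
corresponds to `(W_1/U_1) × ⋯ × (W_{i-1}/U_{i-1}) × Θ(𝒯_i) × (W_{i+1}/U_{i+1}) × ⋯ × (W_n/U_n)`."

## What this file proves (the tree's carriers)

For `(X = E/Φ(ℤ^ι), η)` principally polarised (inner-product model, positively oriented `e`), `Θ ⊂ X` a
hypersurface with `[Θ]_e = ofRealForm (−η)` (every theta divisor, A2-121) whose irreducible components `C`
(finitely many, `IsPrincipalPolarization.finite_components`) have Néron–Severi forms `η_C`, write
`U_C = Λ(η − η_C)⁰`, `B_C = Φ(U_C)/(Λ ∩ U_C)` (`subtorusPeriod`), `ι_C = ρ(C_{U_C}) : B_C → X`, and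
`μ = ρ(sumMatrix U) : ∏_C B_C → X` (`sigmaPiPeriod`) for the addition map.

* §1 **isomorphisms of polarised tori preserve the type**: `IsPolarizedIso.card_eq`, `IsPolarizedIso.det_latticeGram_eq`,
  `IsPolarizedIso.isRiemannForm_of`, `IsPolarizedIso.isPrincipalPolarization_of` / `…_iff`; hence
  **`IsProductFamily.isPrincipalPolarization_sigmaPi`**: the product `(∏_k Y_{V_k}, ⊞_k η|)` of the factors of
  a product family of a p.p.a.v. is a p.p.a.v.
* §2 **(ii): `μ⁻¹(Θ_C)` IS THE CYLINDER `{t | ι_C(t_C) ∈ Θ_C}`** (`preimage_mapMatrix_sumMatrix_component`, from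
  A2-128's `preimage_mapMatrix_sumMatrix_eq_of_invariant`, A2-127's `Θ_C + K_C = Θ_C` and A2-126's
  `U_{C′} ⊆ W_C`), and `μ⁻¹(Θ) = ⋃_C {t | ι_C(t_C) ∈ Θ_C}` (`preimage_mapMatrix_sumMatrix_eq_iUnion`).
* §3 **LEMMA 3.20 (i)+(ii), EXTERNALLY** — **`IsPrincipalPolarization.clemensGriffiths_3_20`**: an isomorphism
  of polarised tori `h : (∏_C B_C, ⊞_C η|_{B_C}) ⥲ (X, η)` (`⇑h = μ`), the product principally polarised, every
  factor `𝒯_C = (B_C, η|_{B_C})` a principally polarised, irreducible (Def. 3.22) torus, `h⁻¹(Θ_C)` the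
  cylinder over `ι_C⁻¹(Θ_C)` — an irreducible hypersurface of `B_C`, the divisor `Θ(𝒯_C)` of a canonical theta
  function of `𝒯_C` (`exists_thetaFunctions_zeroSet_eq_preimage_component`) —, `h⁻¹(Θ_C)` an irreducible
  component of `h⁻¹(Θ) = ⋃_C h⁻¹(Θ_C)`; `…clemensGriffiths_3_20_thetaDivisor` for `Θ = Θ(𝒯) = π({ϑ = 0})`.
* §5 **COR. 3.23 EXTERNALLY, «constructed intrinsically from the components of Θ(𝒯)»** —
  **`IsPrincipalPolarization.clemensGriffiths_3_23_external`**: for ANY isomorphism of polarised tori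
  `(X, η) ⥲ ∏_{k ∈ κ} 𝒯′_k` onto a product of non-zero irreducible p.p.a.v.'s, `#κ = #components(Θ)` and there is
  a bijection `e : components ≃ κ` under which the internal image of `𝒯′_{e C}` is `U_C` and `𝒯_C ≅ 𝒯′_{e C}`
  (A2-131 `ComplexTorusPolarizedDecompositionUniqueExternal` + A2-127).
-- TODO(general form): Lange's Thm. 2.2.1 for a non-principal polarisation (`|L|` with fixed components) is
-- not treated (as in A2-126).

## References

* [ClemensGriffiths1972] C. H. Clemens, P. A. Griffiths, *The intermediate Jacobian of the cubic threefold*,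
  Ann. of Math. 95 (1972), §3 Lemma 3.20, Def. 3.22, Cor. 3.23 (pp. 296–297).
* [Lange2023AbelianVarietiesComplex] H. Lange, *Abelian Varieties over the Complex Numbers* (2023), §2.4.4
  Cor. 2.4.24 / 2.4.31, §3.1.2 Prop. 3.1.4, §1.1.2 Prop. 1.1.13.
* [Debarre1996PolarisationsProduits] O. Debarre, C. R. Acad. Sci. Paris 323 (1996), Corollaire 2.
* [Chirka1989] E. M. Chirka, *Complex Analytic Sets* (1989), §5.3–§5.4.
-/

noncomputable section

open scoped Manifold Topology ComplexOrder Matrix Pointwise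
open Set Filter Function Module TopologicalSpace Complex
open Literature.Algebra.EuclideanLattices

namespace Literature.Geometry.Kaehler

universe u

namespace ComplexTorus

/-! ### §1 Isomorphisms of polarised tori preserve the type; the product of the factors of a p.p.a.v. -/

section IsoInvariants

variable {ι ι' : Type*} [Fintype ι] [Fintype ι'] [DecidableEq ι] [DecidableEq ι']
  {E E' : Type*} [NormedAddCommGroup E] [NormedSpace ℂ E] [NormedAddCommGroup E'] [NormedSpace ℂ E']
  {Φ : (ι → ℝ) ≃L[ℝ] E} {Φ' : (ι' → ℝ) ≃L[ℝ] E'} {η : E [⋀^Fin 2]→L[ℝ] ℝ} {η' : E' [⋀^Fin 2]→L[ℝ] ℝ}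
  {h : ComplexTorus Φ ≃+ ComplexTorus Φ'}

omit [Fintype ι] [Fintype ι'] [DecidableEq ι] [DecidableEq ι'] in
/-- An integer matrix and its real form have the same determinant. [folklore] -/
private theorem det_map_intCast₁₂₉ {m : Type*} [Fintype m] [DecidableEq m] (B : Matrix m m ℤ) :
    (B.map (Int.cast : ℤ → ℝ)).det = (B.det : ℝ) := by
  rw [show B.map (Int.cast : ℤ → ℝ) = (Int.castRingHom ℝ).mapMatrix B from rfl, ← RingHom.map_det, eq_intCast]

omit [Fintype ι] [Fintype ι'] [DecidableEq ι] [DecidableEq ι'] in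
/-- `C^*η' = η` as forms when `η'(Cu, Cv) = η(u, v)` for all `u, v`. [folklore] -/
private theorem pullbackForm_eq_of_forall₁₂₉ (C : E →L[ℂ] E') (hform : ∀ u v : E, η' ![C u, C v] = η ![u, v]) :
    pullbackForm C η' = η := by
  ext x
  have hx : x = ![x 0, x 1] := by
    funext i
    fin_cases i <;> rfl
  rw [hx, pullbackForm_apply]
  exact hform _ _

/-- Isomorphic complex tori have lattices of the same rank: an isomorphism of polarised tori forces
`#ι = #ι'`. [cite: Lange2023AbelianVarietiesComplex, §1.1.2 Prop. 1.1.6, p. 19] -/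
theorem IsPolarizedIso.card_eq (hh : IsPolarizedIso Φ η Φ' η' h) : Fintype.card ι = Fintype.card ι' := by
  obtain ⟨A, B, -, hBA, hAB, -⟩ := hh.exists_matrix
  let e : (ι → ℤ) ≃ₗ[ℤ] (ι' → ℤ) := LinearEquiv.ofLinear (Matrix.toLin' A) (Matrix.toLin' B)
    (by rw [← Matrix.toLin'_mul, hAB, Matrix.toLin'_one]) (by rw [← Matrix.toLin'_mul, hBA, Matrix.toLin'_one])
  have h1 := e.finrank_eq
  rwa [Module.finrank_fintype_fun_eq_card, Module.finrank_fintype_fun_eq_card] at h1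

/-- **An isomorphism of polarised tori preserves the determinant of the Gram matrix** (the type / degree of
the polarisation): `det E_Λ = det E'_{Λ'}`, as `E_Λ = ᵗR E'_{Λ'} R` for the unimodular rational representation `R`.
[cite: Lange2023AbelianVarietiesComplex, §3.1.2 Prop. 3.1.4 («taking imaginary parts of `φ^*H' = H`»), p. 160] -/
theorem IsPolarizedIso.det_latticeGram_eq (hh : IsPolarizedIso Φ η Φ' η' h) :
    (latticeGram Φ η).det = (latticeGram Φ' η').det := by
  obtain ⟨τ⟩ : Nonempty (ι ≃ ι') := Fintype.card_eq.1 hh.card_eq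
  obtain ⟨A, B, C, hBA, -, -, -, hC, hform⟩ := hh.exists_matrix
  have hG := latticeGram_pullbackForm_of_real Φ' Φ (M := A.map (Int.cast : ℤ → ℝ)) (C : E →L[ℂ] E') hC η'
  rw [pullbackForm_eq_of_forall₁₂₉ (C : E →L[ℂ] E') hform] at hG
  -- square reindexing along `τ`
  set P := A.map (Int.cast : ℤ → ℝ) with hP
  set G' := latticeGram Φ' η' with hG'
  have hsq : (P.submatrix τ id)ᵀ * G'.submatrix τ τ * P.submatrix τ id = Pᵀ * G' * P := by
    rw [Matrix.transpose_submatrix, Matrix.submatrix_mul_equiv, Matrix.submatrix_mul_equiv,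
      Matrix.submatrix_id_id]
  have hPA : P.submatrix τ id = (A.submatrix τ id).map (Int.cast : ℤ → ℝ) := by
    rw [hP, Matrix.submatrix_map]
  -- `A□ = A.submatrix τ id` is unimodular: `B□ A□ = 1`
  have hu : IsUnit (A.submatrix τ id).det := by
    have h1 : B.submatrix id τ * A.submatrix τ id = 1 := by
      rw [Matrix.submatrix_mul_equiv, hBA, Matrix.submatrix_id_id]
    have h2 := congrArg Matrix.det h1
    rw [Matrix.det_mul, Matrix.det_one, mul_comm] at h2
    exact IsUnit.of_mul_eq_one _ h2
  have hAA : ((A.submatrix τ id).det : ℝ) * (A.submatrix τ id).det = 1 := by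
    exact_mod_cast Int.isUnit_mul_self hu
  rw [hG, ← hsq, Matrix.det_mul, Matrix.det_mul, Matrix.det_transpose, Matrix.det_submatrix_equiv_self, hPA,
    det_map_intCast₁₂₉, mul_comm, ← mul_assoc, hAA, one_mul]

/-- **An isomorphism of polarised tori pulls a Riemann form back to a Riemann form**: if `η'` polarises `X'`
then `η = ρ_a(h)^*η'` polarises `X`. [cite: Lange2023AbelianVarietiesComplex, §3.1.2 (isomorphisms of polarized abelian varieties), pp. 158–160] -/
theorem IsPolarizedIso.isRiemannForm_of (hh : IsPolarizedIso Φ η Φ' η' h) (hη' : IsRiemannForm Φ' η') :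
    IsRiemannForm Φ η := by
  obtain ⟨A, B, C, -, -, -, -, hC, hform⟩ := hh.exists_matrix
  have := hη'.pullback Φ Φ' (A := A) (f := (C : E →L[ℂ] E')) hC C.injective
  rwa [pullbackForm_eq_of_forall₁₂₉ (C : E →L[ℂ] E') hform] at this

/-- **Isomorphic polarised tori are simultaneously principally polarised.**
[cite: Lange2023AbelianVarietiesComplex, §3.1.2 Prop. 3.1.4, p. 160] -/
theorem IsPolarizedIso.isPrincipalPolarization_of (hh : IsPolarizedIso Φ η Φ' η' h)
    (hP' : IsPrincipalPolarization Φ' η') : IsPrincipalPolarization Φ η :=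
  ⟨hh.isRiemannForm_of hP'.isRiemannForm, by rw [hh.det_latticeGram_eq]; exact hP'.det_latticeGram⟩

/-- `(X, η)` is principally polarised iff `(X', η')` is, along an isomorphism of polarised tori.
[cite: Lange2023AbelianVarietiesComplex, §3.1.2 Prop. 3.1.4, p. 160] -/
theorem IsPolarizedIso.isPrincipalPolarization_iff (hh : IsPolarizedIso Φ η Φ' η' h) :
    IsPrincipalPolarization Φ η ↔ IsPrincipalPolarization Φ' η' :=
  ⟨fun hP ↦ hh.symm.isPrincipalPolarization_of hP, fun hP' ↦ hh.isPrincipalPolarization_of hP'⟩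

variable (Φ) {κ : Type*} [Fintype κ] [DecidableEq κ] {V : κ → Submodule ℝ (ι → ℝ)}

omit [Fintype ι'] [DecidableEq ι'] in
/-- **The product `(∏_k Y_{V_k}, ⊞_k η|_{Y_{V_k}})` of the factors of a product family of a p.p.a.v. is a
p.p.a.v.** (isomorphic to `(X, η)` by the addition map, A2-128). [cite: ClemensGriffiths1972, §3 Lemma 3.20 (i), p. 296] [cite: Lange2023AbelianVarietiesComplex, §2.4.4 Cor. 2.4.31, p. 125] -/
theorem IsProductFamily.isPrincipalPolarization_sigmaPi (hF : IsProductFamily Φ η V)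
    (hP : IsPrincipalPolarization Φ η) :
    IsPrincipalPolarization (sigmaPiPeriod fun k ↦
        subtorusPeriod Φ (V k) (hF.isLatticeSubspace k) (hF.isComplexSubspace k))
      (piForm fun k ↦ pullbackForm (cxSpan Φ (V k)).subtypeL η) := by
  obtain ⟨h, hh, -⟩ := hF.exists_isPolarizedIso_sum Φ
  exact hh.isPrincipalPolarization_of hP

end IsoInvariants

/-! ### §2 (ii): `μ⁻¹(Θ_C)` is the cylinder over `ι_C⁻¹(Θ_C)`; `μ⁻¹(Θ) = ⋃_C μ⁻¹(Θ_C)` -/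

section Cylinder

variable {ι : Type*} [Fintype ι] [DecidableEq ι] {E : Type u} [NormedAddCommGroup E]
  [InnerProductSpace ℂ E] [FiniteDimensional ℂ E] [MeasurableSpace E] [BorelSpace E]
  (Φ : (ι → ℝ) ≃L[ℝ] E) {g q : ℕ} (e : Fin (2 * g) ≃ ι) (hq : 2 * q + 2 = 2 * g)
  {η : E [⋀^Fin 2]→L[ℝ] ℝ} {Θ : Set (ComplexTorus Φ)}
  [Fintype {C : Set (ComplexTorus Φ) // IsIrreducibleComponent 𝓘(ℂ, E) Θ C}]

include hq in
/-- **LEMMA 3.20 (ii): under the addition map `μ : ∏_{C′} B_{C′} → X` the component `Θ_C` pulls back to the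
cylinder `B_1 × ⋯ × ι_C⁻¹(Θ_C) × ⋯ × B_n`**: `μ⁻¹(Θ_C) = {t | ι_C(t_C) ∈ Θ_C}` — `Θ_C + K_C = Θ_C` (A2-127) and
`B_{C′} ⊆ K_C` for `C′ ≠ C` (A2-126). [cite: ClemensGriffiths1972, §3 Lemma 3.20 (ii), p. 296] -/
theorem preimage_mapMatrix_sumMatrix_component (he : orientationSign Φ e = 1) (hΘ : HasPureDim 𝓘(ℂ, E) Θ q)
    (hcl : analyticCycleClass Φ e hq hΘ = ofRealForm (-η))
    (ηC : {C : Set (ComplexTorus Φ) // IsIrreducibleComponent 𝓘(ℂ, E) Θ C} → E [⋀^Fin 2]→L[ℝ] ℝ)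
    (hηC : ∀ C, IsNSForm Φ (ηC C) ∧ analyticCycleClass Φ e hq (C.2.hasPureDim hΘ) = ofRealForm (-ηC C))
    (hF : IsProductFamily Φ η
      (fun C : {C : Set (ComplexTorus Φ) // IsIrreducibleComponent 𝓘(ℂ, E) Θ C} ↦ orthSubspace Φ (η - ηC C) ⊤))
    (C : {C : Set (ComplexTorus Φ) // IsIrreducibleComponent 𝓘(ℂ, E) Θ C}) :
    mapMatrix (sigmaPiPeriod fun C' ↦ subtorusPeriod Φ (orthSubspace Φ (η - ηC C') ⊤)
        (hF.isLatticeSubspace C') (hF.isComplexSubspace C')) Φ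
        (sumMatrix fun C' : {C : Set (ComplexTorus Φ) // IsIrreducibleComponent 𝓘(ℂ, E) Θ C} ↦
          orthSubspace Φ (η - ηC C') ⊤) ⁻¹' (C : Set (ComplexTorus Φ)) =
      {t | mapMatrix (subtorusPeriod Φ (orthSubspace Φ (η - ηC C) ⊤) (hF.isLatticeSubspace C)
          (hF.isComplexSubspace C)) Φ (subtorusMatrix (orthSubspace Φ (η - ηC C) ⊤))
        (sigmaPiHomeomorph (fun C' ↦ subtorusPeriod Φ (orthSubspace Φ (η - ηC C') ⊤)
          (hF.isLatticeSubspace C') (hF.isComplexSubspace C')) t C) ∈ (C : Set (ComplexTorus Φ))} :=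
  preimage_mapMatrix_sumMatrix_eq_of_invariant Φ hF.isLatticeSubspace hF.isComplexSubspace
    (W := orthSubspace Φ (ηC C) ⊤)
    (fun C' hne ↦ orthSubspace_sub_le_orthSubspace_of_ne Φ e hq he hΘ hcl C'.2 C.2
      (fun h ↦ hne (Subtype.ext h).symm) (hηC C').2 (hηC C).2)
    (fun _ hw v ↦ cover_add_mem_component_iff Φ e hq he (C.2.hasPureDim hΘ) (hηC C).2
      (apply_mem_cxSpan Φ _ hw) v)

include hq in
/-- **`μ⁻¹(Θ) = ⋃_C μ⁻¹(Θ_C)`, the union of the cylinders over the `ι_C⁻¹(Θ_C)`** («`Θ = Σ Θ_i` corresponds to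
the sum of the cylinders»). [cite: ClemensGriffiths1972, §3 Lemma 3.20 (ii), p. 296] -/
theorem preimage_mapMatrix_sumMatrix_eq_iUnion (he : orientationSign Φ e = 1) (hΘ : HasPureDim 𝓘(ℂ, E) Θ q)
    (hcl : analyticCycleClass Φ e hq hΘ = ofRealForm (-η))
    (ηC : {C : Set (ComplexTorus Φ) // IsIrreducibleComponent 𝓘(ℂ, E) Θ C} → E [⋀^Fin 2]→L[ℝ] ℝ)
    (hηC : ∀ C, IsNSForm Φ (ηC C) ∧ analyticCycleClass Φ e hq (C.2.hasPureDim hΘ) = ofRealForm (-ηC C))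
    (hF : IsProductFamily Φ η
      (fun C : {C : Set (ComplexTorus Φ) // IsIrreducibleComponent 𝓘(ℂ, E) Θ C} ↦ orthSubspace Φ (η - ηC C) ⊤)) :
    mapMatrix (sigmaPiPeriod fun C' ↦ subtorusPeriod Φ (orthSubspace Φ (η - ηC C') ⊤)
        (hF.isLatticeSubspace C') (hF.isComplexSubspace C')) Φ
        (sumMatrix fun C' : {C : Set (ComplexTorus Φ) // IsIrreducibleComponent 𝓘(ℂ, E) Θ C} ↦
          orthSubspace Φ (η - ηC C') ⊤) ⁻¹' Θ =
      ⋃ C : {C : Set (ComplexTorus Φ) // IsIrreducibleComponent 𝓘(ℂ, E) Θ C},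
        {t | mapMatrix (subtorusPeriod Φ (orthSubspace Φ (η - ηC C) ⊤) (hF.isLatticeSubspace C)
            (hF.isComplexSubspace C)) Φ (subtorusMatrix (orthSubspace Φ (η - ηC C) ⊤))
          (sigmaPiHomeomorph (fun C' ↦ subtorusPeriod Φ (orthSubspace Φ (η - ηC C') ⊤)
            (hF.isLatticeSubspace C') (hF.isComplexSubspace C')) t C) ∈ (C : Set (ComplexTorus Φ))} := by
  have hΘU : Θ = ⋃ C : {C : Set (ComplexTorus Φ) // IsIrreducibleComponent 𝓘(ℂ, E) Θ C}, (C : Set _) := by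
    conv_lhs => rw [eq_biUnion_isIrreducibleComponent Φ hΘ]
    ext x
    simp only [mem_iUnion, mem_setOf_eq, exists_prop, Subtype.exists]
  conv_lhs => arg 2; rw [hΘU]
  rw [preimage_iUnion]
  exact iUnion_congr fun C ↦ preimage_mapMatrix_sumMatrix_component Φ e hq he hΘ hcl ηC hηC hF C

end Cylinder

/-! ### §3 Lemma 3.20 (i)+(ii) externally: `h : (∏_C 𝒯_C) ⥲ (X, η)` with `h⁻¹(Θ_C)` the cylinder over
`Θ(𝒯_C) = ι_C⁻¹(Θ_C)` -/

section External

variable {ι : Type*} [Fintype ι] [DecidableEq ι] {E : Type u} [NormedAddCommGroup E]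
  [InnerProductSpace ℂ E] [FiniteDimensional ℂ E] [MeasurableSpace E] [BorelSpace E]
  (Φ : (ι → ℝ) ≃L[ℝ] E) {g q : ℕ} (e : Fin (2 * g) ≃ ι) (hq : 2 * q + 2 = 2 * g)
  {η : E [⋀^Fin 2]→L[ℝ] ℝ} {Θ : Set (ComplexTorus Φ)}

include hq in
/-- **A p.p.a.v. has finitely many components in a hypersurface of class `c₁(η)`** (they inject into the
finite set of irreducible factors, A2-127 / p26). [cite: ClemensGriffiths1972, §3 Lemma 3.20 («`Θ = Σ_{i=1}^n Θ_i`»), p. 296] -/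
theorem IsPrincipalPolarization.finite_components (hP : IsPrincipalPolarization Φ η)
    (he : orientationSign Φ e = 1) (hΘ : HasPureDim 𝓘(ℂ, E) Θ q)
    (hcl : analyticCycleClass Φ e hq hΘ = ofRealForm (-η)) :
    {C : Set (ComplexTorus Φ) | IsIrreducibleComponent 𝓘(ℂ, E) Θ C}.Finite := by
  obtain ⟨ηC, hηC⟩ := exists_nsForm_components Φ e hq he hΘ
  have hinj := hP.injective_orthSubspace_components Φ e hq he hΘ hcl ηC hηC
  have hfin : (Set.range fun C : {C : Set (ComplexTorus Φ) // IsIrreducibleComponent 𝓘(ℂ, E) Θ C} ↦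
      orthSubspace Φ (η - ηC C) ⊤).Finite := by
    rw [hP.range_orthSubspace_components_eq_polarizedComponents Φ e hq he hΘ hcl ηC hηC]
    exact hP.isRiemannForm.finite_polarizedComponents
  haveI := hfin.to_subtype
  have : Finite {C : Set (ComplexTorus Φ) // IsIrreducibleComponent 𝓘(ℂ, E) Θ C} :=
    Finite.of_injective (fun C ↦ (⟨orthSubspace Φ (η - ηC C) ⊤, mem_range_self C⟩ :
      Set.range fun C : {C : Set (ComplexTorus Φ) // IsIrreducibleComponent 𝓘(ℂ, E) Θ C} ↦
        orthSubspace Φ (η - ηC C) ⊤)) fun C C' h ↦ hinj (congrArg Subtype.val h)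
  exact Set.finite_coe_iff.1 this

include hq in
/-- **`Θ(𝒯_C) = ι_C⁻¹(Θ_C)` is the divisor of a canonical theta function of the factor**: for every component
there are a semicharacter `χ₁` of `(B_C, η|_{B_C})` and a canonical theta function `ϑ₁ ≢ 0` of `L(η|_{B_C}, χ₁)`
with `π_{B_C}⁻¹(ι_C⁻¹ Θ_C) = {ϑ₁ = 0}` (the restriction of a theta function of `𝒪_X(Θ_C)`, A2-127 §2).
[cite: ClemensGriffiths1972, §3 Lemma 3.20 (ii) («`Θ(𝒯_i)`»), p. 296] [cite: Lange2023AbelianVarietiesComplex, §1.3.3 Lemma 1.3.6] -/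
theorem IsPrincipalPolarization.exists_thetaFunctions_zeroSet_eq_preimage_component
    (hP : IsPrincipalPolarization Φ η) (he : orientationSign Φ e = 1) (hΘ : HasPureDim 𝓘(ℂ, E) Θ q)
    (hcl : analyticCycleClass Φ e hq hΘ = ofRealForm (-η)) {C : Set (ComplexTorus Φ)}
    (hC : IsIrreducibleComponent 𝓘(ℂ, E) Θ C) {η₀ : E [⋀^Fin 2]→L[ℝ] ℝ} (hη₀ : IsNSForm Φ η₀)
    (hcl₀ : analyticCycleClass Φ e hq (hC.hasPureDim hΘ) = ofRealForm (-η₀))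
    (hU : IsLatticeSubspace (orthSubspace Φ (η - η₀) ⊤)) (hUc : IsComplexSubspace Φ (orthSubspace Φ (η - η₀) ⊤)) :
    ∃ (χ₁ : (Fin (subRank (orthSubspace Φ (η - η₀) ⊤)) → ℤ) → ℂ) (ϑ₁ : cxSpan Φ (orthSubspace Φ (η - η₀) ⊤) → ℂ),
      IsSemicharacter (subtorusPeriod Φ (orthSubspace Φ (η - η₀) ⊤) hU hUc)
          (pullbackForm (cxSpan Φ (orthSubspace Φ (η - η₀) ⊤)).subtypeL η) χ₁ ∧
        ϑ₁ ∈ thetaFunctions (subtorusPeriod Φ (orthSubspace Φ (η - η₀) ⊤) hU hUc)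
          (canonicalFactor (subtorusPeriod Φ (orthSubspace Φ (η - η₀) ⊤) hU hUc)
            (pullbackForm (cxSpan Φ (orthSubspace Φ (η - η₀) ⊤)).subtypeL η) χ₁) ∧
        ϑ₁ ≠ 0 ∧
        cover (subtorusPeriod Φ (orthSubspace Φ (η - η₀) ⊤) hU hUc) ⁻¹'
            (mapMatrix (subtorusPeriod Φ (orthSubspace Φ (η - η₀) ⊤) hU hUc) Φ
              (subtorusMatrix (orthSubspace Φ (η - η₀) ⊤)) ⁻¹' C) = {y | ϑ₁ y = 0} := by
  have core := hP.isProductPair_nsRadical_component Φ e hq he hΘ hcl hC hη₀ hcl₀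
  have hNS : IsNSForm Φ (η - η₀) := core.1
  obtain ⟨η', χ₀, ϑ₀, -, hχ₀, hϑ₀, -, hzero₀, hcl'⟩ :=
    exists_isNSForm_analyticCycleClass_eq_of_hasPureDim Φ e hq (hC.hasPureDim hΘ) he
  have hηη : η' = η₀ := neg_injective (ofRealForm_injective (hcl'.symm.trans hcl₀))
  subst hηη
  obtain ⟨hχ₁, hϑ₁⟩ := comp_subtypeL_mem_thetaFunctions_of_isNSForm_sub Φ hNS hχ₀ hϑ₀ hU hUc
  obtain ⟨_, _, hP₁, -⟩ := (hP.isProductPair_iff_isPrincipalPolarization_restrict Φ).1 core.2.2.2.2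
  refine ⟨_, _, hχ₁, hϑ₁, hP.comp_subtypeL_ne_zero_component Φ e hq he hΘ hcl hC hη₀ hcl₀ (ϑ₀ := ϑ₀) hzero₀, ?_⟩
  rw [← image_zeroSet_comp_subtypeL_eq_preimage Φ hzero₀ hU hUc
    (isFactor_canonicalFactor _ hP₁.isRiemannForm.isNSForm hχ₁) hϑ₁]
  exact cover_preimage_image_zeroSet (isFactor_canonicalFactor _ hP₁.isRiemannForm.isNSForm hχ₁) hϑ₁

variable [Fintype {C : Set (ComplexTorus Φ) // IsIrreducibleComponent 𝓘(ℂ, E) Θ C}]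

include hq in
/-- **CLEMENS–GRIFFITHS' LEMMA 3.20, (i) AND (ii) EXTERNALLY.** For a p.p.a.v. `𝒯 = (X, η)` and a hypersurface
`Θ = Σ_C Θ_C` of class `c₁(η)` with Néron–Severi forms `η_C` of its components, the factors
`𝒯_C = (B_C, η|_{B_C})`, `B_C` the sub-torus on `U_C = Λ(η − η_C)⁰`, satisfy: **(i)** the addition map is an
isomorphism of polarised tori `h : ∏_C 𝒯_C = (∏_C B_C, ⊞_C η|_{B_C}) ⥲ (X, η)`, the product and every factor
principally polarised, every factor irreducible (Def. 3.22); **(ii)** `h⁻¹(Θ_C) = {t | ι_C(t_C) ∈ Θ_C}` is the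
cylinder `B_1 × ⋯ × Θ(𝒯_C) × ⋯ × B_n` over the irreducible hypersurface `Θ(𝒯_C) = ι_C⁻¹(Θ_C)` of `B_C`, an
irreducible component of `h⁻¹(Θ) = ⋃_C h⁻¹(Θ_C)`. [cite: ClemensGriffiths1972, §3 Lemma 3.20 (i), (ii), pp. 296–297] -/
theorem IsPrincipalPolarization.clemensGriffiths_3_20 (hP : IsPrincipalPolarization Φ η)
    (he : orientationSign Φ e = 1) (hΘ : HasPureDim 𝓘(ℂ, E) Θ q)
    (hcl : analyticCycleClass Φ e hq hΘ = ofRealForm (-η))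
    (ηC : {C : Set (ComplexTorus Φ) // IsIrreducibleComponent 𝓘(ℂ, E) Θ C} → E [⋀^Fin 2]→L[ℝ] ℝ)
    (hηC : ∀ C, IsNSForm Φ (ηC C) ∧ analyticCycleClass Φ e hq (C.2.hasPureDim hΘ) = ofRealForm (-ηC C)) :
    ∃ (hF : IsProductFamily Φ η
        (fun C : {C : Set (ComplexTorus Φ) // IsIrreducibleComponent 𝓘(ℂ, E) Θ C} ↦ orthSubspace Φ (η - ηC C) ⊤))
      (h : ComplexTorus (sigmaPiPeriod fun C ↦ subtorusPeriod Φ (orthSubspace Φ (η - ηC C) ⊤)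
        (hF.isLatticeSubspace C) (hF.isComplexSubspace C)) ≃+ ComplexTorus Φ),
      -- (i) `h : ∏_C 𝒯_C ⥲ 𝒯` is an isomorphism of polarised tori, `h = μ` the addition map
      IsPolarizedIso (sigmaPiPeriod fun C ↦ subtorusPeriod Φ (orthSubspace Φ (η - ηC C) ⊤)
          (hF.isLatticeSubspace C) (hF.isComplexSubspace C))
        (piForm fun C ↦ pullbackForm (cxSpan Φ (orthSubspace Φ (η - ηC C) ⊤)).subtypeL η) Φ η h ∧
      ⇑h = mapMatrix (sigmaPiPeriod fun C ↦ subtorusPeriod Φ (orthSubspace Φ (η - ηC C) ⊤)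
          (hF.isLatticeSubspace C) (hF.isComplexSubspace C)) Φ
        (sumMatrix fun C : {C : Set (ComplexTorus Φ) // IsIrreducibleComponent 𝓘(ℂ, E) Θ C} ↦
          orthSubspace Φ (η - ηC C) ⊤) ∧
      IsPrincipalPolarization (sigmaPiPeriod fun C ↦ subtorusPeriod Φ (orthSubspace Φ (η - ηC C) ⊤)
          (hF.isLatticeSubspace C) (hF.isComplexSubspace C))
        (piForm fun C ↦ pullbackForm (cxSpan Φ (orthSubspace Φ (η - ηC C) ⊤)).subtypeL η) ∧
      (∀ C, IsPrincipalPolarization (subtorusPeriod Φ (orthSubspace Φ (η - ηC C) ⊤)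
          (hF.isLatticeSubspace C) (hF.isComplexSubspace C))
        (pullbackForm (cxSpan Φ (orthSubspace Φ (η - ηC C) ⊤)).subtypeL η) ∧
        IsPolarizedIrreducible (subtorusPeriod Φ (orthSubspace Φ (η - ηC C) ⊤)
          (hF.isLatticeSubspace C) (hF.isComplexSubspace C))
        (pullbackForm (cxSpan Φ (orthSubspace Φ (η - ηC C) ⊤)).subtypeL η)) ∧
      -- (ii) `h⁻¹(Θ_C)` is the cylinder over the irreducible hypersurface `ι_C⁻¹(Θ_C)` of `B_C`
      (∀ C : {C : Set (ComplexTorus Φ) // IsIrreducibleComponent 𝓘(ℂ, E) Θ C}, h ⁻¹' (C : Set (ComplexTorus Φ)) =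
        {t | mapMatrix (subtorusPeriod Φ (orthSubspace Φ (η - ηC C) ⊤) (hF.isLatticeSubspace C)
            (hF.isComplexSubspace C)) Φ (subtorusMatrix (orthSubspace Φ (η - ηC C) ⊤))
          (sigmaPiHomeomorph (fun C' ↦ subtorusPeriod Φ (orthSubspace Φ (η - ηC C') ⊤)
            (hF.isLatticeSubspace C') (hF.isComplexSubspace C')) t C) ∈ (C : Set (ComplexTorus Φ))}) ∧
      (∀ C : {C : Set (ComplexTorus Φ) // IsIrreducibleComponent 𝓘(ℂ, E) Θ C},
        IsIrreducibleAnalyticSet 𝓘(ℂ, ↥(cxSpan Φ (orthSubspace Φ (η - ηC C) ⊤)))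
        (mapMatrix (subtorusPeriod Φ (orthSubspace Φ (η - ηC C) ⊤) (hF.isLatticeSubspace C)
          (hF.isComplexSubspace C)) Φ (subtorusMatrix (orthSubspace Φ (η - ηC C) ⊤)) ⁻¹' (C : Set (ComplexTorus Φ)))) ∧
      h ⁻¹' Θ = ⋃ C : {C : Set (ComplexTorus Φ) // IsIrreducibleComponent 𝓘(ℂ, E) Θ C},
          h ⁻¹' (C : Set (ComplexTorus Φ)) ∧
      ∀ C : {C : Set (ComplexTorus Φ) // IsIrreducibleComponent 𝓘(ℂ, E) Θ C},
        IsIrreducibleComponent 𝓘(ℂ, ∀ C : {C : Set (ComplexTorus Φ) // IsIrreducibleComponent 𝓘(ℂ, E) Θ C},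
          ↥(cxSpan Φ (orthSubspace Φ (η - ηC C) ⊤))) (h ⁻¹' Θ) (h ⁻¹' (C : Set (ComplexTorus Φ))) := by
  classical
  have hF := hP.isProductFamily_orthSubspace_components Φ e hq he hΘ hcl ηC hηC
  obtain ⟨h, hh, hcoe⟩ := hF.exists_isPolarizedIso_sum Φ
  refine ⟨hF, h, hh, hcoe, hF.isPrincipalPolarization_sigmaPi Φ hP, fun C ↦ ⟨?_, ?_⟩, fun C ↦ ?_, fun C ↦ ?_,
    ?_, fun C ↦ ?_⟩
  · exact hF.isPrincipalPolarization_restrict Φ hP C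
  · exact hP.isPolarizedIrreducible_restrict_component Φ e hq he hΘ hcl C.2 (hηC C).1 (hηC C).2 _ _
  · rw [hcoe]
    exact preimage_mapMatrix_sumMatrix_component Φ e hq he hΘ hcl ηC hηC hF C
  · exact hP.isIrreducibleAnalyticSet_preimage_subtorus_component Φ e hq he hΘ hcl C.2 (hηC C).1 (hηC C).2 _ _
  · have hΘU : Θ = ⋃ C : {C : Set (ComplexTorus Φ) // IsIrreducibleComponent 𝓘(ℂ, E) Θ C}, (C : Set _) := by
      conv_lhs => rw [eq_biUnion_isIrreducibleComponent Φ hΘ]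
      ext x
      simp only [mem_iUnion, mem_setOf_eq, exists_prop, Subtype.exists]
    conv_lhs => arg 2; rw [hΘU]
    rw [preimage_iUnion]
  · let hh' : ComplexTorus (sigmaPiPeriod fun C ↦ subtorusPeriod Φ (orthSubspace Φ (η - ηC C) ⊤)
        (hF.isLatticeSubspace C) (hF.isComplexSubspace C)) ≃ₜ ComplexTorus Φ :=
      { toEquiv := h.toEquiv
        continuous_toFun := hh.1.continuous
        continuous_invFun := hh.2.1.continuous }
    exact IsIrreducibleComponent.preimage_homeomorph hh' (hh.1.mdifferentiable (by simp))
      (hh.2.1.mdifferentiable (by simp)) C.2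

end External

/-! ### §4 The theta divisor `Θ(𝒯) = π({ϑ = 0})` of a canonical theta function -/

section ThetaDivisor

variable {ι : Type*} [Fintype ι] [DecidableEq ι] {E : Type u} [NormedAddCommGroup E]
  [InnerProductSpace ℂ E] [FiniteDimensional ℂ E] [MeasurableSpace E] [BorelSpace E]
  (Φ : (ι → ℝ) ≃L[ℝ] E) {g q : ℕ} (e : Fin (2 * g) ≃ ι) (hq : 2 * q + 2 = 2 * g)
  {η : E [⋀^Fin 2]→L[ℝ] ℝ} {χ : (ι → ℤ) → ℂ} {ϑ : E → ℂ}

include hq in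
/-- **LEMMA 3.20 (i)+(ii) FOR THE THETA DIVISOR `Θ(𝒯) = π({ϑ = 0})` of a canonical theta function of the
p.p.a.v. `𝒯 = (X, η)`** (A2-121: `[Θ(𝒯)]_e = c₁(η)`): `∏_C 𝒯_C ⥲ 𝒯` with `Θ_C ↦ B_1 × ⋯ × Θ(𝒯_C) × ⋯ × B_n`.
[cite: ClemensGriffiths1972, §3 Lemma 3.20 (i), (ii), pp. 296–297] -/
theorem IsPrincipalPolarization.clemensGriffiths_3_20_thetaDivisor (hP : IsPrincipalPolarization Φ η)
    (he : orientationSign Φ e = 1) (hχ : IsSemicharacter Φ η χ)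
    (hϑ : ϑ ∈ thetaFunctions Φ (canonicalFactor Φ η χ)) {Θ : Set (ComplexTorus Φ)}
    (hΘ : HasPureDim 𝓘(ℂ, E) Θ q) (hzero : cover Φ ⁻¹' Θ = {w | ϑ w = 0})
    [Fintype {C : Set (ComplexTorus Φ) // IsIrreducibleComponent 𝓘(ℂ, E) Θ C}]
    (ηC : {C : Set (ComplexTorus Φ) // IsIrreducibleComponent 𝓘(ℂ, E) Θ C} → E [⋀^Fin 2]→L[ℝ] ℝ)
    (hηC : ∀ C, IsNSForm Φ (ηC C) ∧ analyticCycleClass Φ e hq (C.2.hasPureDim hΘ) = ofRealForm (-ηC C)) :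
    ∃ (hF : IsProductFamily Φ η
        (fun C : {C : Set (ComplexTorus Φ) // IsIrreducibleComponent 𝓘(ℂ, E) Θ C} ↦ orthSubspace Φ (η - ηC C) ⊤))
      (h : ComplexTorus (sigmaPiPeriod fun C ↦ subtorusPeriod Φ (orthSubspace Φ (η - ηC C) ⊤)
        (hF.isLatticeSubspace C) (hF.isComplexSubspace C)) ≃+ ComplexTorus Φ),
      IsPolarizedIso (sigmaPiPeriod fun C ↦ subtorusPeriod Φ (orthSubspace Φ (η - ηC C) ⊤)
          (hF.isLatticeSubspace C) (hF.isComplexSubspace C))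
        (piForm fun C ↦ pullbackForm (cxSpan Φ (orthSubspace Φ (η - ηC C) ⊤)).subtypeL η) Φ η h ∧
      ⇑h = mapMatrix (sigmaPiPeriod fun C ↦ subtorusPeriod Φ (orthSubspace Φ (η - ηC C) ⊤)
          (hF.isLatticeSubspace C) (hF.isComplexSubspace C)) Φ
        (sumMatrix fun C : {C : Set (ComplexTorus Φ) // IsIrreducibleComponent 𝓘(ℂ, E) Θ C} ↦
          orthSubspace Φ (η - ηC C) ⊤) ∧
      IsPrincipalPolarization (sigmaPiPeriod fun C ↦ subtorusPeriod Φ (orthSubspace Φ (η - ηC C) ⊤)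
          (hF.isLatticeSubspace C) (hF.isComplexSubspace C))
        (piForm fun C ↦ pullbackForm (cxSpan Φ (orthSubspace Φ (η - ηC C) ⊤)).subtypeL η) ∧
      (∀ C, IsPrincipalPolarization (subtorusPeriod Φ (orthSubspace Φ (η - ηC C) ⊤)
          (hF.isLatticeSubspace C) (hF.isComplexSubspace C))
        (pullbackForm (cxSpan Φ (orthSubspace Φ (η - ηC C) ⊤)).subtypeL η) ∧
        IsPolarizedIrreducible (subtorusPeriod Φ (orthSubspace Φ (η - ηC C) ⊤)
          (hF.isLatticeSubspace C) (hF.isComplexSubspace C))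
        (pullbackForm (cxSpan Φ (orthSubspace Φ (η - ηC C) ⊤)).subtypeL η)) ∧
      (∀ C : {C : Set (ComplexTorus Φ) // IsIrreducibleComponent 𝓘(ℂ, E) Θ C}, h ⁻¹' (C : Set (ComplexTorus Φ)) =
        {t | mapMatrix (subtorusPeriod Φ (orthSubspace Φ (η - ηC C) ⊤) (hF.isLatticeSubspace C)
            (hF.isComplexSubspace C)) Φ (subtorusMatrix (orthSubspace Φ (η - ηC C) ⊤))
          (sigmaPiHomeomorph (fun C' ↦ subtorusPeriod Φ (orthSubspace Φ (η - ηC C') ⊤)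
            (hF.isLatticeSubspace C') (hF.isComplexSubspace C')) t C) ∈ (C : Set (ComplexTorus Φ))}) ∧
      (∀ C : {C : Set (ComplexTorus Φ) // IsIrreducibleComponent 𝓘(ℂ, E) Θ C},
        IsIrreducibleAnalyticSet 𝓘(ℂ, ↥(cxSpan Φ (orthSubspace Φ (η - ηC C) ⊤)))
        (mapMatrix (subtorusPeriod Φ (orthSubspace Φ (η - ηC C) ⊤) (hF.isLatticeSubspace C)
          (hF.isComplexSubspace C)) Φ (subtorusMatrix (orthSubspace Φ (η - ηC C) ⊤)) ⁻¹' (C : Set (ComplexTorus Φ)))) ∧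
      h ⁻¹' Θ = ⋃ C : {C : Set (ComplexTorus Φ) // IsIrreducibleComponent 𝓘(ℂ, E) Θ C},
          h ⁻¹' (C : Set (ComplexTorus Φ)) ∧
      ∀ C : {C : Set (ComplexTorus Φ) // IsIrreducibleComponent 𝓘(ℂ, E) Θ C},
        IsIrreducibleComponent 𝓘(ℂ, ∀ C : {C : Set (ComplexTorus Φ) // IsIrreducibleComponent 𝓘(ℂ, E) Θ C},
          ↥(cxSpan Φ (orthSubspace Φ (η - ηC C) ⊤))) (h ⁻¹' Θ) (h ⁻¹' (C : Set (ComplexTorus Φ))) :=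
  hP.clemensGriffiths_3_20 Φ e hq he hΘ (hP.analyticCycleClass_thetaDivisor_eq Φ e hq hχ hϑ he hΘ hzero) ηC hηC

end ThetaDivisor

/-! ### §5 Cor. 3.23 externally: any decomposition into irreducible p.p.a.v.'s is the one cut out by `Θ` -/

section UniqueExternal

variable {ι : Type*} [Fintype ι] [DecidableEq ι] {E : Type u} [NormedAddCommGroup E]
  [InnerProductSpace ℂ E] [FiniteDimensional ℂ E] [MeasurableSpace E] [BorelSpace E]
  (Φ : (ι → ℝ) ≃L[ℝ] E) {g q : ℕ} (e : Fin (2 * g) ≃ ι) (hq : 2 * q + 2 = 2 * g)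
  {η : E [⋀^Fin 2]→L[ℝ] ℝ} {Θ : Set (ComplexTorus Φ)}
  {κ : Type*} [Fintype κ] [DecidableEq κ] {σ : κ → Type*} [∀ k, Fintype (σ k)] [∀ k, DecidableEq (σ k)]
  {F : κ → Type*} [∀ k, NormedAddCommGroup (F k)] [∀ k, NormedSpace ℂ (F k)]
  {Ψ : ∀ k, (σ k → ℝ) ≃L[ℝ] F k} {ω : ∀ k, F k [⋀^Fin 2]→L[ℝ] ℝ}
  {h : ComplexTorus Φ ≃+ ComplexTorus (sigmaPiPeriod Ψ)}

include hq in
/-- **COROLLARY 3.23, EXTERNALLY: "Since the direct summands of `𝒯` in Lemma 3.20 were constructed intrinsically from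
the components of `Θ(𝒯)` … `𝒯` has a unique decomposition into the direct sum of irreducible principally polarized
abelian varieties."** For a p.p.a.v. `𝒯 = (X, η)` with a hypersurface `Θ` of class `c₁(η)` and ANY isomorphism of
polarised tori `h : 𝒯 ⥲ ∏_{k ∈ κ} 𝒯′_k` onto a product of non-zero irreducible p.p.a.v.'s `𝒯′_k = (X_k, ω_k)`: the number
of factors is the number of irreducible components of `Θ`, and there is a bijection `e : components(Θ) ≃ κ` such that
the internal image of the factor `𝒯′_{e C}` is `U_C = Λ(η − η_C)⁰` and `𝒯_C = (B_C, η|_{B_C}) ≅ 𝒯′_{e C}`.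
[cite: ClemensGriffiths1972, §3 Cor. 3.23, p. 297] [cite: Debarre1996PolarisationsProduits, Corollaire 2 b)] -/
theorem IsPrincipalPolarization.clemensGriffiths_3_23_external [∀ k, Nonempty (σ k)]
    (hP : IsPrincipalPolarization Φ η) (he : orientationSign Φ e = 1) (hΘ : HasPureDim 𝓘(ℂ, E) Θ q)
    (hcl : analyticCycleClass Φ e hq hΘ = ofRealForm (-η))
    (ηC : {C : Set (ComplexTorus Φ) // IsIrreducibleComponent 𝓘(ℂ, E) Θ C} → E [⋀^Fin 2]→L[ℝ] ℝ)
    (hηC : ∀ C, IsNSForm Φ (ηC C) ∧ analyticCycleClass Φ e hq (C.2.hasPureDim hΘ) = ofRealForm (-ηC C))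
    (hh : IsPolarizedIso Φ η (sigmaPiPeriod Ψ) (piForm ω) h) (hPk : ∀ k, IsPrincipalPolarization (Ψ k) (ω k))
    (hirr : ∀ k, IsPolarizedIrreducible (Ψ k) (ω k)) :
    Fintype.card κ = {C : Set (ComplexTorus Φ) | IsIrreducibleComponent 𝓘(ℂ, E) Θ C}.ncard ∧
    ∃ V : κ → Submodule ℝ (ι → ℝ), IsProductFamily Φ η V ∧
      (∀ k, IsIndecomposable Φ η (V k)) ∧
      (∀ k, h '' (proj Φ '' (V k : Set (ι → ℝ))) = {t | ∀ j, j ≠ k → sigmaPiHomeomorph Ψ t j = 0}) ∧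
      ∃ eqv : {C : Set (ComplexTorus Φ) // IsIrreducibleComponent 𝓘(ℂ, E) Θ C} ≃ κ,
        ∀ C, V (eqv C) = orthSubspace Φ (η - ηC C) ⊤ ∧
          ∃ f : ComplexTorus (subtorusPeriod Φ (orthSubspace Φ (η - ηC C) ⊤)
              ((hP.isProductFamily_orthSubspace_components Φ e hq he hΘ hcl ηC hηC).isLatticeSubspace C)
              ((hP.isProductFamily_orthSubspace_components Φ e hq he hΘ hcl ηC hηC).isComplexSubspace C)) ≃+
            ComplexTorus (Ψ (eqv C)),
            IsPolarizedIso (subtorusPeriod Φ (orthSubspace Φ (η - ηC C) ⊤)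
                ((hP.isProductFamily_orthSubspace_components Φ e hq he hΘ hcl ηC hηC).isLatticeSubspace C)
                ((hP.isProductFamily_orthSubspace_components Φ e hq he hΘ hcl ηC hηC).isComplexSubspace C))
              (pullbackForm (cxSpan Φ (orthSubspace Φ (η - ηC C) ⊤)).subtypeL η) (Ψ (eqv C)) (ω (eqv C)) f := by
  have hη := hP.isRiemannForm
  have hFU := hP.isProductFamily_orthSubspace_components Φ e hq he hΘ hcl ηC hηC
  have hindU := fun C : {C : Set (ComplexTorus Φ) // IsIrreducibleComponent 𝓘(ℂ, E) Θ C} ↦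
    hP.isIndecomposable_orthSubspace_sub_component Φ e hq he hΘ hcl C.2 (hηC C).1 (hηC C).2
  obtain ⟨V, hF, hindV, himg, hiso⟩ := hh.exists_isProductFamily_isIndecomposable_of_isPolarizedIrreducible hPk hirr
  refine ⟨?_, V, hF, hindV, himg, ?_⟩
  · rw [hh.card_eq_ncard_polarizedComponents_of_isPolarizedIrreducible hPk hirr hη,
      hP.ncard_components_eq_ncard_polarizedComponents Φ e hq he hΘ hcl]
  · obtain ⟨eqv, heqv⟩ := debarre1996_corollaire_2b hFU hF hindU hindV hη
    refine ⟨eqv, fun C ↦ ⟨heqv C, ?_⟩⟩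
    obtain ⟨g', hg'⟩ := hiso (eqv C)
    obtain ⟨f₀, hf₀⟩ := exists_isPolarizedIso_subtorus_of_eq (η := η) (heqv C).symm (hFU.isLatticeSubspace C)
      (hFU.isComplexSubspace C) (hF.isLatticeSubspace (eqv C)) (hF.isComplexSubspace (eqv C))
    exact ⟨_, hf₀.trans hg'⟩

end UniqueExternal

end ComplexTorus

end Literature.Geometry.Kaehler
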